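import Summits.CriticalPhenomena.PercolationContinuityZ3.Theorems.Transplant.FKConnectivityAllQSPSections
import Summits.CriticalPhenomena.PercolationContinuityZ3.Theorems.Transplant.FKConnectivityAllQEdgeToggle
import HarnessLib

/-!
# Connectivity correlation inequalities for `φ_{w,q}`, every `q > 0` — TWO-SUMS, file 1: the parallel laws with a mark on EACH
# part, and network masses as random-cluster masses of the restricted weight vector

Support file (`--supports stmt-CriticalPhenomena-4575`), FK sub-lane `prim-bschramm-fk-1` (gen 6) of the post-continuity
programme; builds on p205010 (kernel theorem, internal audit signed; external expert review pending).  No definitions, no named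
facts, no sorries; standard axioms.  First of the files proving the graph case of Wagner's two-sum theorem (Ann. Comb. 12 (2008),
Thm. 5.8(d): the class of Potts–Rayleigh graphs — `φ_{G,𝐩,q}` edge-negatively associated for every `𝐩` — is closed under
two-sums) on top of fk-2's two-terminal network masses `FK.netMass w q E A = ∑_ω W_w(ω) q^{k(ω ∩ E)} 1_A(ω ∩ E)`
(`…AllQSPMassDefs.lean`) and parallel composition laws (`…AllQSPLaw.lean`, mark on the first part only).

* `FK.netMass_eq_sum_rcWeightW_of_restrict` — the network mass of the part `E` under the ambient weight vector `w` is the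
  random-cluster mass `S_{w'}(A) = ∑_η w'_q(η) 1_A(η)` of the weight vector `w'` that agrees with `w` on `E` and vanishes off `E`
  (pushforward of the product weight under `ω ↦ ω ∩ E`, vdBHK Lemma 2.3); hence `FK.netMass_congr` (the mass of a part depends on
  the parameters of that part only).
* `FK.netMass_parallel_conn_two` / `FK.netMass_parallel_disc_two` / `FK.netMass_parallel_two` — PARALLEL LAWS WITH A MARK ON EACH
  PART (`V₁ ∩ V₂ ⊆ {s,t}`, `M₁` read on the first part, `M₂` on the second):
  `q^{|V|}·NM_{E₁∪E₂}({s↔t} ∩ M₁ ∩ M₂) = NM₁(C∩M₁)·NM₂(Cᶜ∩M₂) + NM₁(Cᶜ∩M₁)·NM₂(C∩M₂) + q·NM₁(C∩M₁)·NM₂(C∩M₂)`,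
  `q^{|V|}·NM_{E₁∪E₂}({s↮t} ∩ M₁ ∩ M₂) = NM₁(Cᶜ∩M₁)·NM₂(Cᶜ∩M₂)`, and their sum — the bilinear form
  `⟨(a,b),(c,d)⟩ = q·ac + ad + bc + bd` of Wagner's Prop. 5.6 / Cor. 5.7 (`N = (−qL^gM^g + L^gM_g + L_gM^g − L_gM_g)/(1−q)` up to
  normalisation), obtained from fk-2's one-mark pointwise identities times the indicator of the second mark.
* mark locality on the second part (`FK.markLocal_openPair₂`, `FK.markLocal_compl_openPair₂`, `FK.markLocal_univ₂`).
[cite: Wagner2006, Prop. 5.6, Cor. 5.7, Thm. 5.8(d) (pp. 13–15)] [cite: Grimmett2006, §1.4 eq. (1.20) (p. 15); §3.8 Thm. (3.91) (p. 62)]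
[cite: VandenbergHaggstromKahn2005, §2.1 Lemma 2.3 (p. 10)]
-/

noncomputable section

namespace Summit.CriticalPhenomena.PercolationContinuityZ3.Theorems

namespace FK

open MeasureTheory SimpleGraph Literature.Probability.LatticeModels Literature.Probability.Percolation
open Literature.Probability.Percolation.BHK2006 (weight weight_nonneg integral_prodBernoulli_eq_sum delW)
open Literature.Probability.Percolation.DecisionTree (ind ind_of_mem ind_of_not_mem ind_nonneg)
open Literature.Probability.Percolation.TwoAvoidanceSets (ind_mul_ind)
open scoped Classical

variable {V : Type*} [Fintype V]

/-! ### Network masses are random-cluster masses of the restricted weight vector -/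

/-- **The network mass of a part is the random-cluster mass of the restricted weights**: if `w' = w` on `E` and `w' = 0` off
`E`, then `netMass w q E A = ∑_η w'_q(η)·1_A(η)` (pushforward of the product weight under `ω ↦ ω ∩ E`; the random-cluster weight
`w'_q(η) = W_{w'}(η) q^{k(η)}` of Grimmett (1.20)). [cite: VandenbergHaggstromKahn2005, §2.1 Lemma 2.3 (p. 10)]
[cite: Grimmett2006, §1.4 eq. (1.20) (p. 15)] -/
theorem netMass_eq_sum_rcWeightW_of_restrict (w w' : Sym2 V → unitInterval) (q : ℝ) {E : Set (Sym2 V)}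
    (hE : ∀ e ∈ E, w' e = w e) (hE' : ∀ e ∉ E, w' e = 0) (A : Set (BondConfig V)) :
    netMass w q E A = ∑ η : BondConfig V, rcWeightW w' q ∅ η * ind A η := by
  have key := BHK2006.integral_comp_sdiff_prodBernoulli' w w' Eᶜ (fun e he => hE' e (fun h => he h))
    (fun e he => hE e (Set.not_notMem.1 he)) (fun η => q ^ clusterCount η ∅ * ind A η)
  rw [integral_prodBernoulli_eq_sum, integral_prodBernoulli_eq_sum] at key
  unfold netMass
  calc ∑ ω : BondConfig V, weight (fun e => (w e : ℝ)) ω * (q ^ clusterCount (ω ∩ E) ∅ * ind A (ω ∩ E))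
      = ∑ ω : BondConfig V, weight (fun e => (w e : ℝ)) ω *
          ((fun η : Set (Sym2 V) => q ^ clusterCount η ∅ * ind A η) (ω \ Eᶜ)) := by
        refine Finset.sum_congr rfl fun ω _ => ?_
        rw [Set.sdiff_compl]
    _ = ∑ η : BondConfig V, weight (fun e => (w' e : ℝ)) η * ((fun η : Set (Sym2 V) => q ^ clusterCount η ∅ * ind A η) η) := key
    _ = _ := by
        refine Finset.sum_congr rfl fun η _ => ?_
        rw [rcWeightW, mul_assoc]

omit [Fintype V] in
/-- The restricted weight vector `delW w Eᶜ` agrees with `w` on the part `E`. [cite: VandenbergHaggstromKahn2005, §2.1 Lemma 2.3 (p. 10)] -/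
theorem delW_compl_of_mem (w : Sym2 V → unitInterval) {E : Set (Sym2 V)} {e : Sym2 V} (he : e ∈ E) : delW w Eᶜ e = w e := by
  unfold delW
  rw [if_neg (fun h' => h' he)]

omit [Fintype V] in
/-- The restricted weight vector `delW w Eᶜ` vanishes off the part `E`. [cite: VandenbergHaggstromKahn2005, §2.1 Lemma 2.3 (p. 10)] -/
theorem delW_compl_of_not_mem (w : Sym2 V → unitInterval) {E : Set (Sym2 V)} {e : Sym2 V} (he : e ∉ E) : delW w Eᶜ e = 0 := by
  unfold delW
  rw [if_pos (show e ∈ Eᶜ from he)]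

/-- **The mass of a part depends on the parameters of that part only**: `w = w'` on `E` ⇒ `netMass w q E A = netMass w' q E A`.
[cite: VandenbergHaggstromKahn2005, §2.1 Lemma 2.3 (p. 10)] -/
theorem netMass_congr {w w' : Sym2 V → unitInterval} (q : ℝ) {E : Set (Sym2 V)} (h : ∀ e ∈ E, w e = w' e)
    (A : Set (BondConfig V)) : netMass w q E A = netMass w' q E A := by
  rw [netMass_eq_sum_rcWeightW_of_restrict w (delW w Eᶜ) q (fun e he => delW_compl_of_mem w he)
      (fun e he => delW_compl_of_not_mem w he) A,
    netMass_eq_sum_rcWeightW_of_restrict w' (delW w Eᶜ) q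
      (fun e he => by rw [delW_compl_of_mem w he, h e he]) (fun e he => delW_compl_of_not_mem w he) A]

/-- The restricted weight vector `delW w Eᶜ` (parameters of `E` kept, all other pairs deleted) realises the restriction:
`netMass w q E A = ∑_η (delW w Eᶜ)_q(η)·1_A(η)`. [cite: VandenbergHaggstromKahn2005, §2.1 Lemma 2.3 (p. 10)] -/
theorem netMass_eq_sum_rcWeightW_delW (w : Sym2 V → unitInterval) (q : ℝ) (E : Set (Sym2 V)) (A : Set (BondConfig V)) :
    netMass w q E A = ∑ η : BondConfig V, rcWeightW (delW w Eᶜ) q ∅ η * ind A η :=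
  netMass_eq_sum_rcWeightW_of_restrict w (delW w Eᶜ) q (fun _ he => delW_compl_of_mem w he)
    (fun _ he => delW_compl_of_not_mem w he) A

omit [Fintype V] in
/-- The restricted weight vector vanishes off the part. [cite: VandenbergHaggstromKahn2005, §2.1 Lemma 2.3 (p. 10)] -/
theorem delW_compl_supported (w : Sym2 V → unitInterval) (E : Set (Sym2 V)) :
    ∀ e, ((delW w Eᶜ e : unitInterval) : ℝ) ≠ 0 → e ∈ E := by
  intro e he
  by_contra h
  apply he
  rw [delW_compl_of_not_mem w h]
  rfl

/-- The total mass of a part is positive for `q > 0`: `NM_E(⊤) = Z_{delW w Eᶜ} > 0`. [cite: Grimmett2006, §1.4 eq. (1.20) (p. 15)] -/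
theorem netMass_univ_pos (w : Sym2 V → unitInterval) {q : ℝ} (hq : 0 < q) (E : Set (Sym2 V)) :
    0 < netMass w q E Set.univ := by
  rw [netMass_eq_sum_rcWeightW_delW]
  have h : ∑ η : BondConfig V, rcWeightW (delW w Eᶜ) q ∅ η * ind (Set.univ : Set (BondConfig V)) η =
      rcPartitionFunctionW (delW w Eᶜ) q ∅ := by
    unfold rcPartitionFunctionW
    exact Finset.sum_congr rfl fun η _ => by rw [ind_of_mem (Set.mem_univ _), mul_one]
  rw [h]
  exact rcPartitionFunctionW_pos _ hq ∅

/-! ### Mark locality on the second part -/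

omit [Fintype V] in
/-- Mark locality on the SECOND part: the trivial mark. [folklore] -/
theorem markLocal_univ₂ (E₁ E₂ : Set (Sym2 V)) :
    ∀ η₁ η₂ : Set (Sym2 V), η₁ ⊆ E₁ → η₂ ⊆ E₂ →
      (η₁ ∪ η₂ ∈ (Set.univ : Set (BondConfig V)) ↔ η₂ ∈ (Set.univ : Set (BondConfig V))) :=
  fun _ _ _ _ => by simp

omit [Fintype V] in
/-- Mark locality on the SECOND part of `{f open}` for a pair `f` off the first part. [folklore] -/
theorem markLocal_openPair₂ {E₁ E₂ : Set (Sym2 V)} {f : Sym2 V} (hf : f ∉ E₁) :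
    ∀ η₁ η₂ : Set (Sym2 V), η₁ ⊆ E₁ → η₂ ⊆ E₂ → (η₁ ∪ η₂ ∈ {η : BondConfig V | f ∈ η} ↔ η₂ ∈ {η : BondConfig V | f ∈ η}) := by
  intro η₁ η₂ h₁ _
  simp only [Set.mem_setOf_eq, Set.mem_union]
  exact ⟨fun h => h.elim (fun h' => absurd (h₁ h') hf) id, Or.inr⟩

omit [Fintype V] in
/-- Mark locality on the SECOND part of `{f closed}` for a pair `f` off the first part. [folklore] -/
theorem markLocal_compl_openPair₂ {E₁ E₂ : Set (Sym2 V)} {f : Sym2 V} (hf : f ∉ E₁) :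
    ∀ η₁ η₂ : Set (Sym2 V), η₁ ⊆ E₁ → η₂ ⊆ E₂ →
      (η₁ ∪ η₂ ∈ ({η : BondConfig V | f ∈ η}ᶜ : Set (BondConfig V)) ↔ η₂ ∈ ({η : BondConfig V | f ∈ η}ᶜ : Set (BondConfig V))) := by
  intro η₁ η₂ h₁ h₂
  rw [Set.mem_compl_iff, Set.mem_compl_iff, markLocal_openPair₂ hf η₁ η₂ h₁ h₂]

/-! ### The parallel laws with a mark on each part -/

section Laws

variable (w : Sym2 V → unitInterval) (q : ℝ) {E₁ E₂ : Set (Sym2 V)} {V₁ V₂ : Set V} {M₁ M₂ : Set (BondConfig V)}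

omit [Fintype V] in
/-- Reading the second mark on the composite configuration: `(ω ∩ (E₁ ∪ E₂)) ∈ M₂ ↔ (ω ∩ E₂) ∈ M₂`. [folklore] -/
theorem mem_mark₂_iff (hM₂ : ∀ η₁ η₂ : Set (Sym2 V), η₁ ⊆ E₁ → η₂ ⊆ E₂ → (η₁ ∪ η₂ ∈ M₂ ↔ η₂ ∈ M₂)) (ω : BondConfig V) :
    ω ∩ (E₁ ∪ E₂) ∈ M₂ ↔ ω ∩ E₂ ∈ M₂ := by
  rw [Set.inter_union_distrib_left]
  exact hM₂ _ _ Set.inter_subset_right Set.inter_subset_right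

omit [Fintype V] in
/-- Splitting off the second mark from an indicator on the composite configuration. [folklore] -/
theorem ind_inter_mark₂ (hM₂ : ∀ η₁ η₂ : Set (Sym2 V), η₁ ⊆ E₁ → η₂ ⊆ E₂ → (η₁ ∪ η₂ ∈ M₂ ↔ η₂ ∈ M₂))
    (A : Set (BondConfig V)) (ω : BondConfig V) :
    ind (A ∩ M₂) (ω ∩ (E₁ ∪ E₂)) = ind A (ω ∩ (E₁ ∪ E₂)) * ind M₂ (ω ∩ E₂) := by
  rw [← ind_mul_ind A M₂]
  congr 1
  by_cases h : ω ∩ E₂ ∈ M₂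
  · rw [ind_of_mem h, ind_of_mem ((mem_mark₂_iff hM₂ ω).2 h)]
  · rw [ind_of_not_mem h, ind_of_not_mem (fun h' => h ((mem_mark₂_iff hM₂ ω).1 h'))]

/-- **Parallel law with a mark on each part, connected part**:
`q^{|V|}·NM_{E₁∪E₂}({s↔t} ∩ M₁ ∩ M₂) = NM₁(C∩M₁)·NM₂(Cᶜ∩M₂) + NM₁(Cᶜ∩M₁)·NM₂(C∩M₂) + q·NM₁(C∩M₁)·NM₂(C∩M₂)`.
[cite: Grimmett2006, §3.8 Thm. (3.91) (p. 62)] [cite: Wagner2006, Prop. 5.6, Cor. 5.7 (pp. 13–14)] -/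
theorem netMass_parallel_conn_two (hd : Disjoint E₁ E₂) (h₁ : ∀ e ∈ E₁, ∀ z ∈ e, z ∈ V₁) (h₂ : ∀ e ∈ E₂, ∀ z ∈ e, z ∈ V₂)
    {s t : V} (hS : V₁ ∩ V₂ ⊆ {s, t}) (hst : s ≠ t)
    (hM₁ : ∀ η₁ η₂ : Set (Sym2 V), η₁ ⊆ E₁ → η₂ ⊆ E₂ → (η₁ ∪ η₂ ∈ M₁ ↔ η₁ ∈ M₁))
    (hM₂ : ∀ η₁ η₂ : Set (Sym2 V), η₁ ⊆ E₁ → η₂ ⊆ E₂ → (η₁ ∪ η₂ ∈ M₂ ↔ η₂ ∈ M₂)) :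
    q ^ Fintype.card V * netMass w q (E₁ ∪ E₂) (openConn s t ∩ M₁ ∩ M₂) =
      netMass w q E₁ (openConn s t ∩ M₁) * netMass w q E₂ ((openConn s t)ᶜ ∩ M₂) +
        netMass w q E₁ ((openConn s t)ᶜ ∩ M₁) * netMass w q E₂ (openConn s t ∩ M₂) +
        q * (netMass w q E₁ (openConn s t ∩ M₁) * netMass w q E₂ (openConn s t ∩ M₂)) := by
  -- pointwise: the one-mark identity times `1_{M₂}(ω ∩ E₂)`
  have hpt : ∀ ω : BondConfig V,
      q ^ Fintype.card V * (q ^ clusterCount (ω ∩ (E₁ ∪ E₂)) ∅ * ind (openConn s t ∩ M₁ ∩ M₂) (ω ∩ (E₁ ∪ E₂))) =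
        (q ^ clusterCount (ω ∩ E₁) ∅ * ind (openConn s t ∩ M₁) (ω ∩ E₁)) *
            (q ^ clusterCount (ω ∩ E₂) ∅ * ind ((openConn s t)ᶜ ∩ M₂) (ω ∩ E₂)) +
          (q ^ clusterCount (ω ∩ E₁) ∅ * ind ((openConn s t)ᶜ ∩ M₁) (ω ∩ E₁)) *
            (q ^ clusterCount (ω ∩ E₂) ∅ * ind (openConn s t ∩ M₂) (ω ∩ E₂)) +
          q * ((q ^ clusterCount (ω ∩ E₁) ∅ * ind (openConn s t ∩ M₁) (ω ∩ E₁)) *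
            (q ^ clusterCount (ω ∩ E₂) ∅ * ind (openConn s t ∩ M₂) (ω ∩ E₂))) := by
    intro ω
    have h := pointwise_parallel_conn (M := M₁) q h₁ h₂ hS hst hM₁ ω
    rw [ind_inter_mark₂ hM₂ (openConn s t ∩ M₁) ω, ← ind_mul_ind (openConn s t)ᶜ M₂ (ω ∩ E₂),
      ← ind_mul_ind (openConn s t) M₂ (ω ∩ E₂)]
    calc q ^ Fintype.card V * (q ^ clusterCount (ω ∩ (E₁ ∪ E₂)) ∅ *
          (ind (openConn s t ∩ M₁) (ω ∩ (E₁ ∪ E₂)) * ind M₂ (ω ∩ E₂)))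
        = (q ^ Fintype.card V * (q ^ clusterCount (ω ∩ (E₁ ∪ E₂)) ∅ * ind (openConn s t ∩ M₁) (ω ∩ (E₁ ∪ E₂)))) *
            ind M₂ (ω ∩ E₂) := by ring
      _ = _ := by rw [h]; ring
  have k1 := sum_weight_mul_restrict_mul w hd (fun η => q ^ clusterCount η ∅ * ind (openConn s t ∩ M₁) η)
    (fun η => q ^ clusterCount η ∅ * ind ((openConn s t)ᶜ ∩ M₂) η)
  have k2 := sum_weight_mul_restrict_mul w hd (fun η => q ^ clusterCount η ∅ * ind ((openConn s t)ᶜ ∩ M₁) η)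
    (fun η => q ^ clusterCount η ∅ * ind (openConn s t ∩ M₂) η)
  have k3 := sum_weight_mul_restrict_mul w hd (fun η => q ^ clusterCount η ∅ * ind (openConn s t ∩ M₁) η)
    (fun η => q ^ clusterCount η ∅ * ind (openConn s t ∩ M₂) η)
  beta_reduce at k1 k2 k3
  unfold netMass
  rw [← k1, ← k2, ← k3, Finset.mul_sum, Finset.mul_sum, ← Finset.sum_add_distrib, ← Finset.sum_add_distrib]
  refine Finset.sum_congr rfl fun ω _ => ?_
  rw [mul_left_comm, hpt ω]; ring

/-- **Parallel law with a mark on each part, disconnected part**: `q^{|V|}·NM_{E₁∪E₂}({s↮t} ∩ M₁ ∩ M₂) = NM₁(Cᶜ∩M₁)·NM₂(Cᶜ∩M₂)`.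
[cite: Grimmett2006, §3.8 Thm. (3.91) (p. 62)] [cite: Wagner2006, Prop. 5.6, Cor. 5.7 (pp. 13–14)] -/
theorem netMass_parallel_disc_two (hd : Disjoint E₁ E₂) (h₁ : ∀ e ∈ E₁, ∀ z ∈ e, z ∈ V₁) (h₂ : ∀ e ∈ E₂, ∀ z ∈ e, z ∈ V₂)
    {s t : V} (hS : V₁ ∩ V₂ ⊆ {s, t}) (hst : s ≠ t)
    (hM₁ : ∀ η₁ η₂ : Set (Sym2 V), η₁ ⊆ E₁ → η₂ ⊆ E₂ → (η₁ ∪ η₂ ∈ M₁ ↔ η₁ ∈ M₁))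
    (hM₂ : ∀ η₁ η₂ : Set (Sym2 V), η₁ ⊆ E₁ → η₂ ⊆ E₂ → (η₁ ∪ η₂ ∈ M₂ ↔ η₂ ∈ M₂)) :
    q ^ Fintype.card V * netMass w q (E₁ ∪ E₂) ((openConn s t)ᶜ ∩ M₁ ∩ M₂) =
      netMass w q E₁ ((openConn s t)ᶜ ∩ M₁) * netMass w q E₂ ((openConn s t)ᶜ ∩ M₂) := by
  have hpt : ∀ ω : BondConfig V,
      q ^ Fintype.card V * (q ^ clusterCount (ω ∩ (E₁ ∪ E₂)) ∅ * ind ((openConn s t)ᶜ ∩ M₁ ∩ M₂) (ω ∩ (E₁ ∪ E₂))) =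
        (q ^ clusterCount (ω ∩ E₁) ∅ * ind ((openConn s t)ᶜ ∩ M₁) (ω ∩ E₁)) *
          (q ^ clusterCount (ω ∩ E₂) ∅ * ind ((openConn s t)ᶜ ∩ M₂) (ω ∩ E₂)) := by
    intro ω
    have h := pointwise_parallel_disc (M := M₁) q h₁ h₂ hS hst hM₁ ω
    rw [ind_inter_mark₂ hM₂ ((openConn s t)ᶜ ∩ M₁) ω, ← ind_mul_ind (openConn s t)ᶜ M₂ (ω ∩ E₂)]
    calc q ^ Fintype.card V * (q ^ clusterCount (ω ∩ (E₁ ∪ E₂)) ∅ *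
          (ind ((openConn s t)ᶜ ∩ M₁) (ω ∩ (E₁ ∪ E₂)) * ind M₂ (ω ∩ E₂)))
        = (q ^ Fintype.card V * (q ^ clusterCount (ω ∩ (E₁ ∪ E₂)) ∅ * ind ((openConn s t)ᶜ ∩ M₁) (ω ∩ (E₁ ∪ E₂)))) *
            ind M₂ (ω ∩ E₂) := by ring
      _ = _ := by rw [h]; ring
  have k1 := sum_weight_mul_restrict_mul w hd (fun η => q ^ clusterCount η ∅ * ind ((openConn s t)ᶜ ∩ M₁) η)
    (fun η => q ^ clusterCount η ∅ * ind ((openConn s t)ᶜ ∩ M₂) η)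
  beta_reduce at k1
  unfold netMass
  rw [← k1, Finset.mul_sum]
  refine Finset.sum_congr rfl fun ω _ => ?_
  rw [mul_left_comm, hpt ω]

/-- **Parallel law with a mark on each part, total**: `q^{|V|}·NM_{E₁∪E₂}(M₁ ∩ M₂) =`
`q·NM₁(C∩M₁)NM₂(C∩M₂) + NM₁(C∩M₁)NM₂(Cᶜ∩M₂) + NM₁(Cᶜ∩M₁)NM₂(C∩M₂) + NM₁(Cᶜ∩M₁)NM₂(Cᶜ∩M₂)` — Wagner's bilinear form
`N ∝ −qL^gM^g + L^gM_g + L_gM^g − L_gM_g` of the two-sum, with "contract `g`" = `{s ↔ t}` and "delete `g`" = `{s ↮ t}` read on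
each part. [cite: Wagner2006, Prop. 5.6, Cor. 5.7 (pp. 13–14)] [cite: Grimmett2006, §3.8 Thm. (3.91) (p. 62)] -/
theorem netMass_parallel_two (hd : Disjoint E₁ E₂) (h₁ : ∀ e ∈ E₁, ∀ z ∈ e, z ∈ V₁) (h₂ : ∀ e ∈ E₂, ∀ z ∈ e, z ∈ V₂)
    {s t : V} (hS : V₁ ∩ V₂ ⊆ {s, t}) (hst : s ≠ t)
    (hM₁ : ∀ η₁ η₂ : Set (Sym2 V), η₁ ⊆ E₁ → η₂ ⊆ E₂ → (η₁ ∪ η₂ ∈ M₁ ↔ η₁ ∈ M₁))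
    (hM₂ : ∀ η₁ η₂ : Set (Sym2 V), η₁ ⊆ E₁ → η₂ ⊆ E₂ → (η₁ ∪ η₂ ∈ M₂ ↔ η₂ ∈ M₂)) :
    q ^ Fintype.card V * netMass w q (E₁ ∪ E₂) (M₁ ∩ M₂) =
      q * (netMass w q E₁ (openConn s t ∩ M₁) * netMass w q E₂ (openConn s t ∩ M₂)) +
        netMass w q E₁ (openConn s t ∩ M₁) * netMass w q E₂ ((openConn s t)ᶜ ∩ M₂) +
        netMass w q E₁ ((openConn s t)ᶜ ∩ M₁) * netMass w q E₂ (openConn s t ∩ M₂) +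
        netMass w q E₁ ((openConn s t)ᶜ ∩ M₁) * netMass w q E₂ ((openConn s t)ᶜ ∩ M₂) := by
  have hsplit : netMass w q (E₁ ∪ E₂) (M₁ ∩ M₂) =
      netMass w q (E₁ ∪ E₂) (openConn s t ∩ M₁ ∩ M₂) + netMass w q (E₁ ∪ E₂) ((openConn s t)ᶜ ∩ M₁ ∩ M₂) := by
    rw [netMass_split w q (E₁ ∪ E₂) (M₁ ∩ M₂) (openConn s t), Set.inter_comm (M₁ ∩ M₂) (openConn s t),
      Set.inter_comm (M₁ ∩ M₂) (openConn s t)ᶜ, ← Set.inter_assoc, ← Set.inter_assoc]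
  rw [hsplit, mul_add, netMass_parallel_conn_two w q hd h₁ h₂ hS hst hM₁ hM₂,
    netMass_parallel_disc_two w q hd h₁ h₂ hS hst hM₁ hM₂]
  ring

end Laws

end FK

end Summit.CriticalPhenomena.PercolationContinuityZ3.Theorems

end
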